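import Mathlib
import HarnessLib
import Literature.Analysis.FluidPDE.SelfSimilar
import Literature.Analysis.FluidPDE.AxisymmetricEuler
import Literature.Analysis.FluidPDE.AncientMildDrift
import Summits.NavierStokesRegularity.NavierStokesRegularity.Theorems.ScenarioCensusAncientSymmetry

/-!
# Blow-up scenario census — the helical / time-Type-I OPEN targets are stated SHARPLY (witnesses)

Cell `pub/ns-census` (director-ns KEY req102, D-0154 (A), 2026-08-28), typer seat `ns-census-typer-2`.
Companion of `ScenarioCensusAncientSymmetry.lean` (rows A8, A8t, A2b′, R8t): those typed OPEN targets
conclude "every slice is a.e. (an axial) CONSTANT", not "`u ≡ 0`", because the duality-form ancient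
mild class contains every time-dependent SPATIAL CONSTANT `u(t, x) = b(t)` (KNSS 2009 §1, "parasitic
solutions"; tree theorem `isAncientMildSolution_timeConst`). This file makes that caveat kernel-checked,
so that wave-2 lines attaching to the Row decls (director-ns 06:37Z (2)) do not aim at a false
strengthening:

* `not_helical_bounded_liouville_zero_form` — the naive form of A8 ("bounded helical ancient mild ⇒
  `u(t) =ᵐ 0`") is FALSE: witness `u ≡ e₃`;
* `not_helical_typeI_liouville_zero_form` — the naive form of A8t / R8t ("… time-Type-I … ⇒
  `u(t) =ᵐ 0`") is FALSE: witness `u(t, x) = (−t)^{−1/2} e₃`, which is moreover rotated-DSS with factor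
  `2` and `R = 1` (so it lies in the class of `Row_R8t`) and axisymmetric (class of `Row_A2b'`);
* `row_R8t_witness` — the same field meets EVERY hypothesis of `Row_R8t` and its conclusion with
  `β(t) = (−t)^{−1/2}` (the row is consistent and its conclusion is attained non-trivially).

No Navier–Stokes dynamics beyond `isAncientMildSolution_timeConst` is used. No summit statement is
proved or claimed here; nothing in this file is a claim about Navier–Stokes regularity.
-/

noncomputable section

set_option linter.dupNamespace false

open MeasureTheory Set Filter Topology
open scoped ENNReal NNReal

namespace Summit.NavierStokesRegularity.NavierStokesRegularity.Theorems.ScenarioCensus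

open Literature.Analysis

/-- Rotations about the axis fix the axial constants: `R_θ (a e₃) = a e₃`. -/
theorem rotZ_smul_eZ_census (θ a : ℝ) :
    FluidPDE.rotZ θ (a • (FluidPDE.eZ : EuclideanSpace ℝ (Fin 3))) = a • FluidPDE.eZ := by
  ext i
  fin_cases i <;> simp [FluidPDE.eZ]

/-- A non-zero constant field is not a.e. zero (Lebesgue measure on `ℝ³` is non-zero). -/
theorem not_ae_eq_zero_const {b : EuclideanSpace ℝ (Fin 3)} (hb : b ≠ 0) :
    ¬ ((fun _ : EuclideanSpace ℝ (Fin 3) => b) =ᵐ[volume] (0 : EuclideanSpace ℝ (Fin 3) → EuclideanSpace ℝ (Fin 3))) := by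
  intro h
  haveI : (ae (volume : Measure (EuclideanSpace ℝ (Fin 3)))).NeBot := ae_neBot.2 (NeZero.ne _)
  have h' : ∀ᵐ _ : EuclideanSpace ℝ (Fin 3) ∂volume, b = 0 := by
    filter_upwards [h] with x hx
    simpa using hx
  exact hb (Filter.eventually_const.1 h')

/-- `e₃ ≠ 0`. -/
theorem eZ_ne_zero : (FluidPDE.eZ : EuclideanSpace ℝ (Fin 3)) ≠ 0 := by
  intro h
  have := congrFun (congrArg (⇑) h) 2
  simp [FluidPDE.eZ] at this

/-- **The naive ("`u ≡ 0`") form of the bounded helical Liouville statement A8 is FALSE.** The constant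
field `u ≡ e₃` is a bounded ancient mild solution (duality form; `isBoundedAncientMildSolution_timeConst`)
with measurable slices, invariant under every screw motion of every pitch, and no slice is a.e. `0`.
Hence `Row_A8` (conclusion: slices a.e. CONSTANT) is the right typed target. -/
theorem not_helical_bounded_liouville_zero_form :
    ¬ (∀ h : ℝ, h ≠ 0 → ∀ u : ℝ → EuclideanSpace ℝ (Fin 3) → EuclideanSpace ℝ (Fin 3),
        FluidPDE.IsBoundedAncientMildSolution 1 u → (∀ t < 0, AEStronglyMeasurable (u t) volume) →
          (∀ t < 0, ∀ (θ : ℝ) (x : EuclideanSpace ℝ (Fin 3)),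
              u t (FluidPDE.rotZ θ x + (h * θ) • EuclideanSpace.single 2 (1 : ℝ)) =
                FluidPDE.rotZ θ (u t x)) →
            ∀ t < 0, u t =ᵐ[volume] 0) := by
  intro H
  set u : ℝ → EuclideanSpace ℝ (Fin 3) → EuclideanSpace ℝ (Fin 3) := fun _ _ => FluidPDE.eZ with hu_def
  have hmild : FluidPDE.IsBoundedAncientMildSolution 1 u :=
    FluidPDE.isBoundedAncientMildSolution_timeConst 1 (b := fun _ => FluidPDE.eZ)
      ⟨‖(FluidPDE.eZ : EuclideanSpace ℝ (Fin 3))‖, fun _ _ => le_rfl⟩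
  have hmeas : ∀ t < 0, AEStronglyMeasurable (u t) volume := fun _ _ => aestronglyMeasurable_const
  have hscrew : ∀ t < 0, ∀ (θ : ℝ) (x : EuclideanSpace ℝ (Fin 3)),
      u t (FluidPDE.rotZ θ x + (1 * θ) • EuclideanSpace.single 2 (1 : ℝ)) = FluidPDE.rotZ θ (u t x) := by
    intro t _ θ x
    simp only [hu_def]
    simpa using (rotZ_smul_eZ_census θ 1).symm
  have h0 := H 1 one_ne_zero u hmild hmeas hscrew (-1) (by norm_num)
  exact not_ae_eq_zero_const eZ_ne_zero h0

/-- The time-Type-I axial witness `w(t, x) = (−t)^{−1/2} e₃` (junk value `0` for `t ≥ 0`, from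
`Real.sqrt` and `x/0 = 0`). Written as a local abbreviation inside statements below; this lemma records
its norm: `‖w(t,x)‖ = 1/√(−t)` for `t < 0`. -/
theorem norm_typeI_axial_witness {t : ℝ} (ht : t < 0) (x : EuclideanSpace ℝ (Fin 3)) :
    ‖(fun (s : ℝ) (_ : EuclideanSpace ℝ (Fin 3)) => (1 / Real.sqrt (-s)) • (FluidPDE.eZ : EuclideanSpace ℝ (Fin 3))) t x‖
      = 1 / Real.sqrt (-t) := by
  have hs : 0 < Real.sqrt (-t) := Real.sqrt_pos.2 (by linarith)
  simp [norm_smul, FluidPDE.eZ, abs_of_pos hs]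

/-- The witness is rotated-DSS with factor `2` and trivial rotation (indeed self-similar):
`2 · w(4t, 2x) = w(t, x)` since `√(−4t) = 2√(−t)`. -/
theorem isRotatedDSS_typeI_axial_witness :
    FluidPDE.IsRotatedDSS 2 (LinearIsometryEquiv.refl ℝ (EuclideanSpace ℝ (Fin 3)))
      (fun (s : ℝ) (_ : EuclideanSpace ℝ (Fin 3)) => (1 / Real.sqrt (-s)) • (FluidPDE.eZ : EuclideanSpace ℝ (Fin 3))) := by
  intro t x
  change (2 : ℝ) • ((1 / Real.sqrt (-(2 ^ 2 * t))) • (FluidPDE.eZ : EuclideanSpace ℝ (Fin 3))) =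
    (1 / Real.sqrt (-t)) • FluidPDE.eZ
  have key : (2 : ℝ) * (1 / Real.sqrt (-(2 ^ 2 * t))) = 1 / Real.sqrt (-t) := by
    rcases lt_or_ge t 0 with ht | ht
    · have h4 : Real.sqrt (-(2 ^ 2 * t)) = 2 * Real.sqrt (-t) := by
        rw [show -((2 : ℝ) ^ 2 * t) = 2 ^ 2 * (-t) by ring, Real.sqrt_mul (by positivity) (-t),
          Real.sqrt_sq (by norm_num : (0 : ℝ) ≤ 2)]
      have hs : Real.sqrt (-t) ≠ 0 := (Real.sqrt_pos.2 (by linarith)).ne'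
      rw [h4]
      field_simp
    · have h1 : Real.sqrt (-(2 ^ 2 * t)) = 0 := Real.sqrt_eq_zero'.2 (by nlinarith)
      have h2 : Real.sqrt (-t) = 0 := Real.sqrt_eq_zero'.2 (by linarith)
      simp [h1, h2]
  rw [smul_smul, key]

/-- **The naive ("`u ≡ 0`") form of the time-Type-I helical / rotated-DSS / axisymmetric Liouville
statements (A8t, R8t, A2b′) is FALSE.** The field `w(t, x) = (−t)^{−1/2} e₃` is an ancient mild solution
(duality form), has measurable slices, is invariant under every screw motion of every pitch (and
axisymmetric), is rotated-DSS with factor `2`, `R = 1`, satisfies `HasTypeITimeDecay 1`, and NO slice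
`t < 0` is a.e. zero. Hence the typed targets conclude "a.e. axial constant `β(t) e₃`". -/
theorem not_helical_typeI_liouville_zero_form :
    ¬ (∀ h : ℝ, h ≠ 0 → ∀ (c : ℝ), 1 < c →
        ∀ (R : EuclideanSpace ℝ (Fin 3) ≃ₗᵢ[ℝ] EuclideanSpace ℝ (Fin 3))
          (u : ℝ → EuclideanSpace ℝ (Fin 3) → EuclideanSpace ℝ (Fin 3)),
          FluidPDE.IsAncientMildSolution 1 u → (∀ t < 0, AEStronglyMeasurable (u t) volume) →
            FluidPDE.IsRotatedDSS c R u →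
            (∀ t < 0, ∀ (θ : ℝ) (x : EuclideanSpace ℝ (Fin 3)),
                u t (FluidPDE.rotZ θ x + (h * θ) • EuclideanSpace.single 2 (1 : ℝ)) =
                  FluidPDE.rotZ θ (u t x)) →
              (∃ C : ℝ, FluidPDE.HasTypeITimeDecay C u) → ∀ t < 0, u t =ᵐ[volume] 0) := by
  intro H
  set w : ℝ → EuclideanSpace ℝ (Fin 3) → EuclideanSpace ℝ (Fin 3) :=
    fun s _ => (1 / Real.sqrt (-s)) • (FluidPDE.eZ : EuclideanSpace ℝ (Fin 3)) with hw_def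
  have hmild : FluidPDE.IsAncientMildSolution 1 w :=
    FluidPDE.isAncientMildSolution_timeConst 1 (fun s => (1 / Real.sqrt (-s)) • FluidPDE.eZ)
  have hmeas : ∀ t < 0, AEStronglyMeasurable (w t) volume := fun _ _ => aestronglyMeasurable_const
  have hscrew : ∀ t < 0, ∀ (θ : ℝ) (x : EuclideanSpace ℝ (Fin 3)),
      w t (FluidPDE.rotZ θ x + (1 * θ) • EuclideanSpace.single 2 (1 : ℝ)) = FluidPDE.rotZ θ (w t x) := by
    intro t _ θ x
    simp only [hw_def]
    exact (rotZ_smul_eZ_census θ _).symm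
  have hdec : ∃ C : ℝ, FluidPDE.HasTypeITimeDecay C w :=
    ⟨1, fun t ht x => by rw [hw_def, norm_typeI_axial_witness ht x]⟩
  have h0 := H 1 one_ne_zero 2 one_lt_two (LinearIsometryEquiv.refl ℝ _) w hmild hmeas
    isRotatedDSS_typeI_axial_witness hscrew hdec (-1) (by norm_num)
  have hne : (1 / Real.sqrt (-(-1 : ℝ))) • (FluidPDE.eZ : EuclideanSpace ℝ (Fin 3)) ≠ 0 := by
    rw [neg_neg, Real.sqrt_one, div_one, one_smul]
    exact eZ_ne_zero
  exact not_ae_eq_zero_const hne h0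

/-- **`Row_R8t` is consistent and its conclusion is attained non-trivially:** the witness
`w(t,x) = (−t)^{−1/2} e₃` satisfies every hypothesis of `Row_R8t` (pitch `1`, factor `2`, `R = 1`) and
its conclusion with `β(t) = (−t)^{−1/2} ≠ 0`. -/
theorem row_R8t_witness :
    ∃ (u : ℝ → EuclideanSpace ℝ (Fin 3) → EuclideanSpace ℝ (Fin 3)),
      FluidPDE.IsAncientMildSolution 1 u ∧ (∀ t < 0, AEStronglyMeasurable (u t) volume) ∧
      FluidPDE.IsRotatedDSS 2 (LinearIsometryEquiv.refl ℝ (EuclideanSpace ℝ (Fin 3))) u ∧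
      (∀ t < 0, ∀ (θ : ℝ) (x : EuclideanSpace ℝ (Fin 3)),
          u t (FluidPDE.rotZ θ x + (1 * θ) • EuclideanSpace.single 2 (1 : ℝ)) = FluidPDE.rotZ θ (u t x)) ∧
      FluidPDE.HasTypeITimeDecay 1 u ∧
      (∀ t < 0, u t =ᵐ[volume] fun _ => (1 / Real.sqrt (-t)) • FluidPDE.eZ) ∧
      ¬ (∀ t < 0, u t =ᵐ[volume] 0) := by
  refine ⟨fun s _ => (1 / Real.sqrt (-s)) • FluidPDE.eZ,
    FluidPDE.isAncientMildSolution_timeConst 1 (fun s => (1 / Real.sqrt (-s)) • FluidPDE.eZ),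
    fun _ _ => aestronglyMeasurable_const, isRotatedDSS_typeI_axial_witness, ?_, ?_, ?_, ?_⟩
  · intro t _ θ x
    exact (rotZ_smul_eZ_census θ _).symm
  · intro t ht x
    rw [norm_typeI_axial_witness ht x]
  · intro t _
    exact Filter.EventuallyEq.rfl
  · intro h
    have h0 := h (-1) (by norm_num)
    have hne : (1 / Real.sqrt (-(-1 : ℝ))) • (FluidPDE.eZ : EuclideanSpace ℝ (Fin 3)) ≠ 0 := by
      rw [neg_neg, Real.sqrt_one, div_one, one_smul]
      exact eZ_ne_zero
    exact not_ae_eq_zero_const hne h0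

/-- For the record, the witness also lies in the class of `Row_A2b'` (it is axisymmetric) — the
axisymmetric time-Type-I target, too, can only conclude "a.e. axial constant". -/
theorem isAxisymmetric_typeI_axial_witness (t : ℝ) :
    FluidPDE.IsAxisymmetric
      ((fun (s : ℝ) (_ : EuclideanSpace ℝ (Fin 3)) => (1 / Real.sqrt (-s)) • (FluidPDE.eZ : EuclideanSpace ℝ (Fin 3))) t) :=
  fun θ _ => (rotZ_smul_eZ_census θ _).symm

end Summit.NavierStokesRegularity.NavierStokesRegularity.Theorems.ScenarioCensus

end
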